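import Summits.QuantumFields.YangMills.Theorems.BalabanLadderNTConjugateResponse
import Summits.QuantumFields.YangMills.Theorems.BalabanLadderNTMarkovMirrorAffine
import HarnessLib

/-!
# Crux `NT` / seam `UVSeamRec.stub_floorsEngine` (S-B): CUMULANT POLARISATION — the third cumulant in MIRROR SHAPE as
# a mirror form; objects and algebra (card `cumulant-polarisation`, kernel-checked in the tree)

Definition helper file (`--supports stmt-QuantumFields-20043`; owner RULINGS R78/R87) of the fleet lead
`ym-spine-19353-p1`, kernel-checking in the tree crux-ideate card 10 `cumulant-polarisation` (seat
`ym-cruxidea-19353-2` g10, HOME sketch `CumulantPolarisation.lean`, rc 0).  THE LEVER: a third cumulant is the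
covariance of one variable against the CENTRED PRODUCT of the other two; for the clause-(ii) triple in MIRROR SHAPE
`(v, θg, θh)` (`v` at positive, `g, h` reflected to negative times, one cube) this reads
`Q3(v, θg, θh) = B(P, Ṽ_v)`, `P = (Wᴿ_g − ⟨Wᴿ_g⟩)(Wᴿ_h − ⟨Wᴿ_h⟩)`, `B(X, Y) = Cov_T(X∘Θ₀, Y)` — so reflection
positivity couples the clause-(ii) floor to the bare mirror floor MF (sequel `…NTCumulantPolarisation`).
WHICH CLAUSE IT SERVES: conjuncts 2 AND 3 of the REGISTERED `UVSeamRec.stub_floorsEngine` from ONE sign-sensitive floor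
(sequel `…UVSeamRecFloorsEngineOfQ3MirrorFloor`).

This file: the torus-expectation algebra (`torusE_sub`, `torusE_centred_centred(_mul)`), the third cumulant of three
observables `torusCum3` (`torusK3` is its site-density instance, `rfl`) and **`torusCum3_eq_cov_centred`**
`κ₃(A, B, C) = Cov_T((B − ⟨B⟩)(C − ⟨C⟩), A)`; the objects `reflSmear` (`Wᴿ_w`, the reflected-species smearing),
`cubeSmear` (`Ṽ_w`), `mirrorForm` (`B`), `cprod` (centred product), `cdensR` (centred reflected-site density) with
their admissibility (continuous / bounded / cylinder) and the bilinear expansion `mirrorForm_cprod_cubeSmear`.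
General compact `G`, any `r`, every `β`, every torus.

HONEST FRAMING.  Definitions and exact algebra; no floor or ceiling is asserted; nothing about NT, the seam or a gap.
[cite: GlimmJaffe1987, §19.1; OsterwalderSeiler1978, §2]
-/

set_option autoImplicit false

noncomputable section

open scoped SchwartzMap
open MeasureTheory Filter Topology
open Literature.MathematicalPhysics.QuantumFieldTheory Literature.MathematicalPhysics.QuantumLattice
open Literature.Probability.LatticeModels
open Summit.QuantumFields.YangMills.Cruxes.OSLegsFromFemtoAndGap.DlrCollarTransfer
open Summit.QuantumFields.YangMills.Cruxes.OSLegsFromFemtoAndGap.DlrCollarTransfer.StubLower (mem_cubeSites_iff)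
open Summit.QuantumFields.YangMills.Cruxes.OSLegsAtWeakCouplingC.InheritedAmplitudeGates.StubInherit
  (integrable_lift)
open Summit.QuantumFields.YangMills.Cruxes.NT.Reflection
open Summit.QuantumFields.YangMills.Cruxes.NT.MarkovMirror
open Summit.QuantumFields.YangMills.Cruxes.NT.ConjugateResponse (torusE_comp_cfgReflect cov_negReflect_self_nonneg)

namespace Summit.QuantumFields.YangMills.Cruxes.NT.CumulantPolarisation

/-! ## §1 Torus-expectation algebra; the third cumulant as a covariance against a centred product -/

section Torus

variable (G : Type) [Group G] [TopologicalSpace G] [IsTopologicalGroup G] [CompactSpace G]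
  [MeasurableSpace G] [BorelSpace G] (r : LatticeRep G)

/-- Subtractivity of the torus expectation over continuous observables. [folklore] -/
theorem torusE_sub (β : ℝ) (L : ℕ) {F H : LGConfig 4 G → ℝ} (hF : Continuous F) (hH : Continuous H) :
    torusE G r β L (fun U => F U - H U) = torusE G r β L F - torusE G r β L H := by
  unfold torusE
  exact integral_sub (integrable_lift G r β hF) (integrable_lift G r β hH)

/-- The third cumulant (connected three-point function) of three observables on the torus of side `2L+1` — the shape of
the tree's `torusK3` with the site densities replaced by arbitrary observables. -/
def torusCum3 (β : ℝ) (L : ℕ) (A B C : LGConfig 4 G → ℝ) : ℝ :=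
  torusE G r β L (fun U => A U * B U * C U)
    - torusE G r β L A * torusE G r β L (fun U => B U * C U)
    - torusE G r β L B * torusE G r β L (fun U => A U * C U)
    - torusE G r β L C * torusE G r β L (fun U => A U * B U)
    + 2 * (torusE G r β L A * torusE G r β L B * torusE G r β L C)

/-- `torusK3` is the third cumulant of the three site densities (definitional). -/
theorem torusK3_eq_torusCum3 (β : ℝ) (L : ℕ) (x y z : Fin 4 → ℤ) :
    torusK3 G r β L x y z = torusCum3 G r β L (dens G r x) (dens G r y) (dens G r z) := rfl

/-- Expansion: `E[((B − b)(C − c)) · A] = E[ABC] − c E[AB] − b E[AC] + b c E[A]`. [folklore] -/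
theorem torusE_centred_centred_mul (β : ℝ) (L : ℕ) {A B C : LGConfig 4 G → ℝ} (hA : Continuous A)
    (hB : Continuous B) (hC : Continuous C) (b c : ℝ) :
    torusE G r β L (fun U => ((B U - b) * (C U - c)) * A U) =
      torusE G r β L (fun U => A U * B U * C U) - c * torusE G r β L (fun U => A U * B U)
        - b * torusE G r β L (fun U => A U * C U) + b * c * torusE G r β L A := by
  have e1 : (fun U => ((B U - b) * (C U - c)) * A U) =
      fun U => ((A U * B U * C U - c * (A U * B U)) - b * (A U * C U)) + b * c * A U := by
    funext U; ring
  have hAB : Continuous fun U => A U * B U := hA.mul hB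
  have hAC : Continuous fun U => A U * C U := hA.mul hC
  have hABC : Continuous fun U => A U * B U * C U := hAB.mul hC
  have h1 : Continuous fun U => A U * B U * C U - c * (A U * B U) := hABC.sub (continuous_const.mul hAB)
  have h2 : Continuous fun U => (A U * B U * C U - c * (A U * B U)) - b * (A U * C U) :=
    h1.sub (continuous_const.mul hAC)
  have h3 : Continuous fun U => b * c * A U := continuous_const.mul hA
  have h4 : Continuous fun U => b * (A U * C U) := continuous_const.mul hAC
  have h5 : Continuous fun U => c * (A U * B U) := continuous_const.mul hAB
  rw [e1, torusE_add G r β L h2 h3, torusE_sub G r β L h1 h4, torusE_sub G r β L hABC h5,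
    torusE_const_mul G r β L c (fun U => A U * B U), torusE_const_mul G r β L b (fun U => A U * C U),
    torusE_const_mul G r β L (b * c) A]

/-- Expansion: `E[(B − b)(C − c)] = E[BC] − c E[B] − b E[C] + b c`. [folklore] -/
theorem torusE_centred_centred (β : ℝ) (L : ℕ) {B C : LGConfig 4 G → ℝ} (hB : Continuous B) (hC : Continuous C)
    (b c : ℝ) :
    torusE G r β L (fun U => (B U - b) * (C U - c)) =
      torusE G r β L (fun U => B U * C U) - c * torusE G r β L B - b * torusE G r β L C + b * c := by
  have e1 : (fun U => (B U - b) * (C U - c)) = fun U => ((B U * C U - c * B U) - b * C U) + b * c := by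
    funext U; ring
  have hBC : Continuous fun U => B U * C U := hB.mul hC
  have h1 : Continuous fun U => B U * C U - c * B U := hBC.sub (continuous_const.mul hB)
  have h2 : Continuous fun U => (B U * C U - c * B U) - b * C U := h1.sub (continuous_const.mul hC)
  have h3 : Continuous fun _ : LGConfig 4 G => b * c := continuous_const
  have h4 : Continuous fun U => b * C U := continuous_const.mul hC
  have h5 : Continuous fun U => c * B U := continuous_const.mul hB
  rw [e1, torusE_add G r β L h2 h3, torusE_sub G r β L h1 h4, torusE_sub G r β L hBC h5,
    torusE_const_mul G r β L c B, torusE_const_mul G r β L b C]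
  unfold torusE
  haveI := isProbabilityMeasure_wilsonMeasure (d := 4) (L := 2 * L + 1) r.ρ r.continuous β
  rw [integral_const, smul_eq_mul, probReal_univ, one_mul]

/-- **The third cumulant is the covariance of one variable against the centred product of the other two**:
`κ₃(A, B, C) = E[(B − E B)(C − E C) · A] − E[(B − E B)(C − E C)] · E[A]`. [cite: GlimmJaffe1987, §19.1] -/
theorem torusCum3_eq_cov_centred (β : ℝ) (L : ℕ) {A B C : LGConfig 4 G → ℝ} (hA : Continuous A)
    (hB : Continuous B) (hC : Continuous C) :
    torusCum3 G r β L A B C =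
      torusE G r β L (fun U => ((B U - torusE G r β L B) * (C U - torusE G r β L C)) * A U) -
        torusE G r β L (fun U => (B U - torusE G r β L B) * (C U - torusE G r β L C)) * torusE G r β L A := by
  rw [torusE_centred_centred_mul G r β L hA hB hC, torusE_centred_centred G r β L hB hC]
  unfold torusCum3
  ring

end Torus

/-! ## §2 The smearings, the mirror form, the centred product; admissibility -/

section Smear

variable (G : Type) [Group G] [TopologicalSpace G] [IsTopologicalGroup G] [CompactSpace G]
  [MeasurableSpace G] [BorelSpace G] (r : LatticeRep G)

/-- The reflected-species smearing `Wᴿ_w = Σ_{x ∈ Q} w(x) · Σ_q plane_q(x_q)` (`x_q = x − e₀` electric, `x` magnetic)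
carried by the cube `Q = (c, b)` (vocabulary of the tree's `Q2_thetaTest_eq_torusCov_reflSmear`). -/
def reflSmear (c : Fin 4 → ℤ) (b : ℕ) (w : (Fin 4 → ℤ) → ℝ) : LGConfig 4 G → ℝ := fun V =>
  ∑ x ∈ cubeSites c b, w x *
    ∑ q : {q : Fin 4 × Fin 4 // q.1 < q.2}, plane G r q.1 (if q.1.1 = 0 then x - Pi.single 0 1 else x) V

/-- The site-weighted smearing `Ṽ_w = Σ_{y ∈ Q} w(y) · dens_y` carried by the cube `Q = (c, b)`. -/
def cubeSmear (c : Fin 4 → ℤ) (b : ℕ) (w : (Fin 4 → ℤ) → ℝ) : LGConfig 4 G → ℝ := fun V =>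
  ∑ y ∈ cubeSites c b, w y * dens G r y V

/-- The mirror form `B(X, Y) = Cov_T(X∘Θ₀, Y)` on the torus of side `2L+1` (`Θ₀ = cfgReflect`). -/
def mirrorForm (β : ℝ) (L : ℕ) (X Y : LGConfig 4 G → ℝ) : ℝ :=
  torusE G r β L (fun V => X (cfgReflect V) * Y V) - torusE G r β L (fun V => X (cfgReflect V)) * torusE G r β L Y

/-- The centred product `(X − ⟨X⟩)(Y − ⟨Y⟩)` of two observables (torus means at `(β, L)`). -/
def cprod (β : ℝ) (L : ℕ) (X Y : LGConfig 4 G → ℝ) : LGConfig 4 G → ℝ := fun V =>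
  (X V - torusE G r β L X) * (Y V - torusE G r β L Y)

/-- The centred reflected-site density `dens_{θ₀y} − ⟨dens_{θ₀y}⟩`. -/
def cdensR (β : ℝ) (L : ℕ) (y : Fin 4 → ℤ) : LGConfig 4 G → ℝ := fun V =>
  dens G r (siteReflect y) V - torusE G r β L (dens G r (siteReflect y))

/-- The centred reflected-site density is continuous. [folklore] -/
theorem continuous_cdensR (β : ℝ) (L : ℕ) (y : Fin 4 → ℤ) : Continuous (cdensR G r β L y) :=
  (continuous_dens r _).sub continuous_const

omit [CompactSpace G] [BorelSpace G] in
/-- The reflected-species smearing is continuous (tree `MarkovMirror.continuous_reflSmear`). [folklore] -/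
theorem continuous_reflSmear' (c : Fin 4 → ℤ) (b : ℕ) (w : (Fin 4 → ℤ) → ℝ) : Continuous (reflSmear G r c b w) :=
  continuous_reflSmear G r _ _

/-- The cube smearing is continuous (tree `MarkovMirror.continuous_cubeSmear`). [folklore] -/
theorem continuous_cubeSmear' (c : Fin 4 → ℤ) (b : ℕ) (w : (Fin 4 → ℤ) → ℝ) : Continuous (cubeSmear G r c b w) :=
  continuous_cubeSmear G r c b w

/-- The centred product of two continuous observables is continuous. [folklore] -/
theorem continuous_cprod (β : ℝ) (L : ℕ) {X Y : LGConfig 4 G → ℝ} (hX : Continuous X) (hY : Continuous Y) :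
    Continuous (cprod G r β L X Y) :=
  (hX.sub continuous_const).mul (hY.sub continuous_const)

/-- The centred product of two bounded observables is bounded. [folklore] -/
theorem exists_abs_cprod_le (β : ℝ) (L : ℕ) {X Y : LGConfig 4 G → ℝ} (hX : ∃ M : ℝ, ∀ V, |X V| ≤ M)
    (hY : ∃ M : ℝ, ∀ V, |Y V| ≤ M) : ∃ M : ℝ, ∀ V, |cprod G r β L X Y V| ≤ M := by
  obtain ⟨MX, hMX⟩ := hX
  obtain ⟨MY, hMY⟩ := hY
  refine ⟨(MX + |torusE G r β L X|) * (MY + |torusE G r β L Y|), fun V => ?_⟩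
  have h1 : |X V - torusE G r β L X| ≤ MX + |torusE G r β L X| := (abs_sub _ _).trans (by linarith [hMX V])
  have h2 : |Y V - torusE G r β L Y| ≤ MY + |torusE G r β L Y| := (abs_sub _ _).trans (by linarith [hMY V])
  show |(X V - torusE G r β L X) * (Y V - torusE G r β L Y)| ≤ _
  rw [abs_mul]
  exact mul_le_mul h1 h2 (abs_nonneg _) ((abs_nonneg _).trans h1)

/-- The centred product of two cylinder observables is a cylinder observable on the union of the links. [folklore] -/
theorem isCylinder_cprod (β : ℝ) (L : ℕ) {X Y : LGConfig 4 G → ℝ}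
    {SX SY : Finset (Literature.MathematicalPhysics.QuantumLattice.ZdEdge 4)} (hX : IsCylinder X SX)
    (hY : IsCylinder Y SY) : IsCylinder (cprod G r β L X Y) (SX ∪ SY) := by
  classical
  intro U V h
  show (X U - torusE G r β L X) * (Y U - torusE G r β L Y) = (X V - torusE G r β L X) * (Y V - torusE G r β L Y)
  rw [hX fun e he => h e (by simp [Finset.mem_coe.1 he]), hY fun e he => h e (by simp [Finset.mem_coe.1 he])]

/-- The torus mean of the reflected-species smearing: `⟨Wᴿ_w⟩ = Σ_y w(y) ⟨dens_{θ₀y}⟩` (reflection invariance of the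
torus measure and the site chirality formula `dens_siteReflect`). [folklore] -/
theorem torusE_reflSmear (β : ℝ) (L : ℕ) (c : Fin 4 → ℤ) (b : ℕ) (w : (Fin 4 → ℤ) → ℝ) :
    torusE G r β L (reflSmear G r c b w) = ∑ y ∈ cubeSites c b, w y * torusE G r β L (dens G r (siteReflect y)) := by
  rw [← torusE_comp_cfgReflect G r β L (reflSmear G r c b w)]
  simp only [reflSmear, ← dens_siteReflect G r]
  exact torusE_sum_mul G r β L _ w (fun y => dens G r (siteReflect y)) fun y _ => continuous_dens r _

/-- The centred reflected smearing read on the reflected field is the smearing of the centred reflected-site densities: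
`Wᴿ_w(Θ₀V) − ⟨Wᴿ_w⟩ = Σ_y w(y) (dens_{θ₀y}(V) − ⟨dens_{θ₀y}⟩)`. [folklore] -/
theorem reflSmear_cfgReflect_sub_mean (β : ℝ) (L : ℕ) (c : Fin 4 → ℤ) (b : ℕ) (w : (Fin 4 → ℤ) → ℝ)
    (V : LGConfig 4 G) :
    reflSmear G r c b w (cfgReflect V) - torusE G r β L (reflSmear G r c b w) =
      ∑ y ∈ cubeSites c b, w y * cdensR G r β L y V := by
  rw [torusE_reflSmear G r β L c b w]
  simp only [reflSmear, ← dens_siteReflect G r, cdensR, mul_sub, Finset.sum_sub_distrib]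

/-- The centred product of two reflected smearings, read on the reflected field, as a double smearing of products of
centred reflected-site densities. [folklore] -/
theorem cprod_reflSmear_cfgReflect (β : ℝ) (L : ℕ) (c : Fin 4 → ℤ) (b : ℕ) (wg wh : (Fin 4 → ℤ) → ℝ)
    (V : LGConfig 4 G) :
    cprod G r β L (reflSmear G r c b wg) (reflSmear G r c b wh) (cfgReflect V) =
      ∑ p ∈ cubeSites c b ×ˢ cubeSites c b, (wg p.1 * wh p.2) * (cdensR G r β L p.1 V * cdensR G r β L p.2 V) := by
  show (reflSmear G r c b wg (cfgReflect V) - torusE G r β L (reflSmear G r c b wg)) *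
      (reflSmear G r c b wh (cfgReflect V) - torusE G r β L (reflSmear G r c b wh)) = _
  rw [reflSmear_cfgReflect_sub_mean, reflSmear_cfgReflect_sub_mean, Finset.sum_mul_sum, Finset.sum_product]
  refine Finset.sum_congr rfl fun y _ => Finset.sum_congr rfl fun z _ => ?_
  ring

/-- **Bilinear expansion of the mirror form of the centred product against a cube smearing.** [folklore] -/
theorem mirrorForm_cprod_cubeSmear (β : ℝ) (L : ℕ) (c : Fin 4 → ℤ) (b : ℕ) (wg wh wv : (Fin 4 → ℤ) → ℝ) :
    mirrorForm G r β L (cprod G r β L (reflSmear G r c b wg) (reflSmear G r c b wh)) (cubeSmear G r c b wv) =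
      ∑ p ∈ cubeSites c b ×ˢ cubeSites c b, ∑ x ∈ cubeSites c b, (wg p.1 * wh p.2) * wv x *
        (torusE G r β L (fun V => (cdensR G r β L p.1 V * cdensR G r β L p.2 V) * dens G r x V) -
          torusE G r β L (fun V => cdensR G r β L p.1 V * cdensR G r β L p.2 V) * torusE G r β L (dens G r x)) := by
  have eW := cprod_reflSmear_cfgReflect G r β L c b wg wh
  have eF : (fun V => cprod G r β L (reflSmear G r c b wg) (reflSmear G r c b wh) (cfgReflect V) *
      cubeSmear G r c b wv V) =
      fun V => (∑ p ∈ cubeSites c b ×ˢ cubeSites c b,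
          (wg p.1 * wh p.2) * (cdensR G r β L p.1 V * cdensR G r β L p.2 V)) *
        (∑ x ∈ cubeSites c b, wv x * dens G r x V) := by
    funext V; rw [eW]; rfl
  have eF' : (fun V => cprod G r β L (reflSmear G r c b wg) (reflSmear G r c b wh) (cfgReflect V)) =
      fun V => ∑ p ∈ cubeSites c b ×ˢ cubeSites c b,
        (wg p.1 * wh p.2) * (cdensR G r β L p.1 V * cdensR G r β L p.2 V) := funext eW
  have eV : cubeSmear G r c b wv = fun V => ∑ x ∈ cubeSites c b, wv x * dens G r x V := rfl
  unfold mirrorForm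
  rw [eF, eF', eV]
  exact torusCov_sum_sum G r β L (cubeSites c b ×ˢ cubeSites c b) (cubeSites c b) (fun p => wg p.1 * wh p.2) wv
    (fun p V => cdensR G r β L p.1 V * cdensR G r β L p.2 V) (fun x => dens G r x)
    (fun p _ => (continuous_cdensR G r β L _).mul (continuous_cdensR G r β L _)) (fun x _ => continuous_dens r x)

end Smear

end Summit.QuantumFields.YangMills.Cruxes.NT.CumulantPolarisation

end
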